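import Literature.Geometry.Riemannian.LiQingShiPinching
import Literature.Geometry.Riemannian.LiQingShiPinchingDecomposition
import Summits.SmoothPoincare4.SmoothPoincare4.Theses.InformationMetricHadamard
import Summits.SmoothPoincare4.SmoothPoincare4.Theses.EinsteinBulk

/-!
# Crux `YamabePinchedEinsteinBulk` (stmt-SmoothPoincare4-7996), line `Sketch`: the reduction to the
two printed layers of Li–Qing–Shi 2017

The crux — Li–Qing–Shi 2017, Thm. 1.8 at `n = 5`, typed verbatim in routes
`InformationMetricHadamard` and `EinsteinBulk` — is the tree's named fact
`Literature.Geometry.Riemannian.liQingShi_pinching_five` with `IsPoincareEinsteinFilling` and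
`IsConformalTo` unfolded (`liQingShi_pinching_five.inlined`). The printed proof splits into
Thm. 1.5 (child 1, `liQingShi_volumeComparison_five`: hyperbolic volume ratio `≥ (1-δ)²` from the
Yamabe bound) and the curvature gap from the volume gap (child 2, `liQingShi_curvatureGap_five`),
and the tree proves the assembly `liQingShi_pinching_five_holds_of`. This file records, for both
route copies of the crux:

* `helper_reduction` (registered stub of line `Sketch`): child 1 → child 2 → crux
  (`InformationMetricHadamard` copy);
* `yamabePinchedEinsteinBulk_of_liQingShi` / `einsteinBulk_yamabePinchedEinsteinBulk_of_liQingShi`: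
  the crux from the named fact itself (CONDITIONAL results: the crux closes only when the fact, or
  both children, are discharged);
* `einsteinBulk_yamabePinchedEinsteinBulk_of_layers`: the `EinsteinBulk` copy from the two children.

Everything is proved (kind = proof); no definitions.
-/

noncomputable section

-- the prescribed namespace `Summit.<P>.<Sub>.…` duplicates `SmoothPoincare4` (P = Sub)
set_option linter.dupNamespace false

namespace Summit.SmoothPoincare4.SmoothPoincare4.Cruxes.YamabePinchedEinsteinBulk.Sketch

open Literature.Geometry.Riemannian (liQingShi_volumeComparison_five liQingShi_curvatureGap_five
  liQingShi_pinching_five liQingShi_pinching_five_holds_of)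

/-- **The crux (`InformationMetricHadamard` copy) from the named fact** `liQingShi_pinching_five`
(Li–Qing–Shi 2017, Thm. 1.8 at `n = 5`): the route decl is the fact with
`IsPoincareEinsteinFilling` (a conjunction) and `IsConformalTo` (definitional) unfolded, i.e.
`liQingShi_pinching_five.inlined`. Conditional on the fact. [cite: LiQingShi2017, Thm. 1.8] -/
theorem yamabePinchedEinsteinBulk_of_liQingShi (h : liQingShi_pinching_five) :
    Summit.SmoothPoincare4.SmoothPoincare4.Theses.InformationMetricHadamard.YamabePinchedEinsteinBulk :=
  liQingShi_pinching_five.inlined h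

/-- **The crux (`EinsteinBulk` copy) from the named fact** `liQingShi_pinching_five`; conditional
on the fact. [cite: LiQingShi2017, Thm. 1.8] -/
theorem einsteinBulk_yamabePinchedEinsteinBulk_of_liQingShi (h : liQingShi_pinching_five) :
    Summit.SmoothPoincare4.SmoothPoincare4.Theses.EinsteinBulk.YamabePinchedEinsteinBulk :=
  liQingShi_pinching_five.inlined h

/-- **Registered stub `helper_reduction` of line `Sketch`: the crux from the two printed layers.**
Child 1 (`liQingShi_volumeComparison_five`, Thm. 1.5) and child 2 (`liQingShi_curvatureGap_five`,
proof of Thm. 1.8, Steps 1–2) give the fact by the tree's assembly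
`liQingShi_pinching_five_holds_of` (`δ = min(δ'/2, 1)`), and the fact is the route decl.
[cite: LiQingShi2017, Thm. 1.8 (proof, pp. 12–13)] -/
theorem helper_reduction :
    liQingShi_volumeComparison_five → liQingShi_curvatureGap_five →
      Summit.SmoothPoincare4.SmoothPoincare4.Theses.InformationMetricHadamard.YamabePinchedEinsteinBulk :=
  fun h15 hgap => yamabePinchedEinsteinBulk_of_liQingShi (liQingShi_pinching_five_holds_of h15 hgap)

/-- The `EinsteinBulk` copy of the crux from the two printed layers.
[cite: LiQingShi2017, Thm. 1.8 (proof, pp. 12–13)] -/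
theorem einsteinBulk_yamabePinchedEinsteinBulk_of_layers (h15 : liQingShi_volumeComparison_five)
    (hgap : liQingShi_curvatureGap_five) :
    Summit.SmoothPoincare4.SmoothPoincare4.Theses.EinsteinBulk.YamabePinchedEinsteinBulk :=
  einsteinBulk_yamabePinchedEinsteinBulk_of_liQingShi (liQingShi_pinching_five_holds_of h15 hgap)

end Summit.SmoothPoincare4.SmoothPoincare4.Cruxes.YamabePinchedEinsteinBulk.Sketch

end
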